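import Mathlib

/-!
# Ranks of small-branching well-founded relations on a large type descend one universe

[OURS · L1 W4.3 · crux `WeightedConstruction` stmt-ResolutionOfSingularities-0571; refuter res-L1-w43-tri-2, TRIAGE v8 O-v8.1]
AI-written; weaker than expert review.  NOT a statement of any manuscript.  Pure set theory (Mathlib only).

Use.  idea-2's (WO*) packaging (`Sketch-R6b.lean`: positions bundled as `BPos : Type 1`, `iotaRank := Acc.rank` of the
certified successor relation, hence `Ordinal.{1}`) must deliver a key `ι : (R : Type) → [CommRing R] → R → Ordinal.{0}` for the
door clause.  The successor relation is SMALL-BRANCHING (the successors of a position are indexed by presented centres, primes of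
the cobordant algebra and strict transforms — a `Type 0` family), and for such relations every rank is `< Ordinal.univ.{0,1}`, i.e.
a lift of an `Ordinal.{0}`; so the universe bump is bookkeeping, not a hypothesis.  This file proves exactly that, for any
`α : Type (u+1)` and any relation whose predecessor sets are `Small.{u}`:
* `rank_lt_univ_of_small` — `(h : Acc r a).rank < Ordinal.univ.{u, u+1}`;
* `exists_lift_eq_rank_of_small` — the rank is `Ordinal.lift` of an ordinal one universe down;
* `exists_rank_fun_of_small_branching` — for a well-founded small-branching `r` there is `ι₀ : α → Ordinal.{u}` with
  `Ordinal.lift (ι₀ a) = (hwf.apply a).rank` and `r a b → ι₀ a < ι₀ b` (def-free packaging: an `∃`, no new definition).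
-/

set_option linter.dupNamespace false
set_option autoImplicit false

namespace Summit.ResolutionOfSingularities.ResolutionOfSingularities.Theorems.WeightedConstruction.Negative.SmallBranchingRank

universe u

variable {α : Type (u + 1)} {r : α → α → Prop}

/-- An ordinal below `univ.{u, u+1}` has its successor below `univ.{u, u+1}` as well (it is a lift, and lifts commute with
`succ`). [folklore] -/
theorem succ_lt_univ {o : Ordinal.{u + 1}} (ho : o < Ordinal.univ.{u, u + 1}) :
    Order.succ o < Ordinal.univ.{u, u + 1} := by
  have hmem : o ∈ Set.range (Ordinal.liftPrincipalSeg.{u, u + 1} : Ordinal.{u} → Ordinal.{u + 1}) :=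
    Ordinal.liftPrincipalSeg.{u, u + 1}.mem_range_iff_rel.2 (by simpa using ho)
  obtain ⟨o', rfl⟩ := hmem
  have h := Ordinal.liftPrincipalSeg.{u, u + 1}.lt_top (Order.succ o')
  simpa [Ordinal.liftPrincipalSeg_coe, Ordinal.lift_succ] using h

/-- **Small branching ⇒ rank below `univ`.**  If every predecessor set of `r` on `α : Type (u+1)` is `u`-small, then the rank of
every accessible element is `< Ordinal.univ.{u, u+1}`. [folklore] -/
theorem rank_lt_univ_of_small (hs : ∀ a : α, Small.{u} {b // r b a}) {a : α} (h : Acc r a) :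
    h.rank < Ordinal.univ.{u, u + 1} := by
  induction h with
  | intro a h ih =>
    rw [Acc.rank_eq]
    apply Ordinal.iSup_lt_of_lt_cof
    · rw [Ordinal.cof_univ]
      have hsm := (Cardinal.small_iff_lift_mk_lt_univ.{u + 1, u}).1 (hs a)
      simpa using hsm
    · intro b
      exact succ_lt_univ (ih b b.2)

/-- The rank of an accessible element of a small-branching relation is the lift of an ordinal one universe down. [folklore] -/
theorem exists_lift_eq_rank_of_small (hs : ∀ a : α, Small.{u} {b // r b a}) {a : α} (h : Acc r a) :
    ∃ o : Ordinal.{u}, Ordinal.lift.{u + 1} o = h.rank := by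
  have hmem : h.rank ∈ Set.range (Ordinal.liftPrincipalSeg.{u, u + 1} : Ordinal.{u} → Ordinal.{u + 1}) :=
    Ordinal.liftPrincipalSeg.{u, u + 1}.mem_range_iff_rel.2 (by simpa using rank_lt_univ_of_small hs h)
  obtain ⟨o, ho⟩ := hmem
  exact ⟨o, by simpa [Ordinal.liftPrincipalSeg_coe] using ho⟩

/-- **Def-free packaging.**  For a well-founded small-branching relation on `α : Type (u+1)` there is a rank function with values
in `Ordinal.{u}` lifting to `Acc.rank` and strictly increasing along `r`.  (For idea-2: `α = BPos`, `r = CertSucc p`, `u = 0`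
gives `ι⋆ : BPos → Ordinal.{0}` with the (c9′) drop `iotaRank_lt_of_certStep`.) [folklore] -/
theorem exists_rank_fun_of_small_branching (hwf : WellFounded r) (hs : ∀ a : α, Small.{u} {b // r b a}) :
    ∃ ι₀ : α → Ordinal.{u},
      (∀ a : α, Ordinal.lift.{u + 1} (ι₀ a) = (hwf.apply a).rank) ∧ ∀ a b : α, r a b → ι₀ a < ι₀ b := by
  choose ι₀ hι₀ using fun a => exists_lift_eq_rank_of_small hs (hwf.apply a)
  refine ⟨ι₀, hι₀, fun a b hab => ?_⟩
  have h := Acc.rank_lt_of_rel (hwf.apply b) hab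
  rw [← hι₀ a, ← hι₀ b] at h
  exact Ordinal.lift_lt.1 h

end Summit.ResolutionOfSingularities.ResolutionOfSingularities.Theorems.WeightedConstruction.Negative.SmallBranchingRank
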